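import Summits.NavierStokesRegularity.NavierStokesRegularity.Theorems.ScenarioCensusEpochMeter
import HarnessLib

/-!
# LINE g16-3 «epoch-meter» port, part 2/2: §D the census rows, §E (L′) decides every row BY NAME, §F controls and calibration; census KEYS `Row_A2epG` / `Row_A2epA` / `Row_A2epC` +
# `_excluded`, `Row_A2epB` / `Row_A2epU` (OPEN), edges

Re-homed for the scenario census (typer seat ns-census-typer-1 g9; the cells A2epG / A2epA / A2epC are MEMBERS OF RECORD «DECIDED IN KERNEL IN FILES» of block A2 since census
v1.97 (item 65: critic PASS; ref PRE-CHECK ✓; lead label); this port makes them TREE-decided): VERBATIM PORT of ns-idea-2 LINE g16-3 «epoch-meter»,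
`pub/ideators/ns-idea-2/lines/epoch-meter/line-epoch-meter.lean` sha16 5c4cdebe765f5398 (510 l., lean check rc 0, 0 sorry), split for the 400-line rule into
`ScenarioCensusEpochMeter` (§A–§C) → `…EpochMeterRows` (§D–§F + census KEYS).  Lean text VERBATIM in namespace `…Theorems.ScenarioCensus.EpochMeter` (the line's
`…Lines.EpochMeter` re-homed); port edits: `local notation "E3"` → `abbrev E3` (typer lint), `set_option linter.unusedVariables false` dropped (the record: a port must drop it;
unused binders `_`-prefixed where the linter asks, proof text only), the `variable {C} {u}` line repeated at the head of part 2, `@[conjecture]` on the OPEN rows `Row_A2epB` /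
`Row_A2epU` (typed only), five one-line docstrings added (gate lint).  Statements untouched.

No census VALUE is moved here (the cells become TREE-decided by name; booking is the lead's); NS regularity is NOT proved; (L′) ⟨10661⟩ is untouched; no
summit statement is proved by this file.
-/

-- the summit and its single problem share the name `NavierStokesRegularity` (D-0017 nested layout)
set_option linter.dupNamespace false

noncomputable section

open Set Function Filter Metric
open scoped Topology
open Literature.Analysis.FluidPDE
open Summit.NavierStokesRegularity.NavierStokesRegularity.Theorems
open Summit.NavierStokesRegularity.NavierStokesRegularity.Theorems.SimilarityEnstrophy

namespace Summit.NavierStokesRegularity.NavierStokesRegularity.Theorems.ScenarioCensus.EpochMeter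

variable {C : ℝ} {u : ℝ → E3 → E3}

/-! ## D. Census rows (keys A2ep*) -/

/-- **Row A2epG** — receding quiet epochs with log-lengths `→ ∞` on cores of GROWING aperture, one level `ε < 1`,
force triviality.  EXCLUDED (PROVED, master row). -/
def Row_A2epG : Prop :=
  ∀ (C : ℝ) (u : ℝ → E3 → E3), IsTypeIAncientMild C u →
    (∃ ε : ℝ, ε < 1 ∧ HasLongQuietEpochs ε u) → ∀ t < 0, ∀ x, u t x = 0

/-- **Row A2epG holds** (master row). -/
theorem row_A2epG : Row_A2epG := fun _ _ hu ⟨_, hε, h⟩ => eq_zero_of_longQuietEpochs hu hε h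

/-- **Row A2epA** — for every ratio `r` and horizon `T` an ALL-SPACE `ε`-quiet epoch `[a, b]`, `b ≤ T`,
`a ≤ r b`, one level `ε < 1` ⇒ `u ≡ 0`.  EXCLUDED (PROVED). -/
def Row_A2epA : Prop :=
  ∀ (C : ℝ) (u : ℝ → E3 → E3), IsTypeIAncientMild C u →
    (∃ ε : ℝ, ε < 1 ∧ ∀ r T : ℝ, T < 0 → ∃ a b : ℝ, a < b ∧ b ≤ T ∧ a ≤ r * b ∧ EpochQuietAll ε u a b) →
    ∀ t < 0, ∀ x, u t x = 0

/-- **Row A2epA holds.** -/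
theorem row_A2epA : Row_A2epA := fun _ _ hu ⟨_, hε, h⟩ =>
  eq_zero_of_longQuietEpochs hu hε (hasLongQuietEpochs_of_forall h)

/-- **Row A2epC** — recurrent `ε`-quiet core SLICES at EVERY level `ε > 0` and aperture `K > 0` ⇒ `u ≡ 0`.
EXCLUDED (PROVED) — CALIBRATION ONLY: this is the contrapositive of the tree's
`ScrewBlowdown.substantial_at_large_scales` (ns-idea-4 v1.9), read through the meter; no novelty claimed. -/
def Row_A2epC : Prop :=
  ∀ (C : ℝ) (u : ℝ → E3 → E3), IsTypeIAncientMild C u →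
    (∀ ε > (0 : ℝ), ∀ K > (0 : ℝ), ∀ T < (0 : ℝ), ∃ s < T, ∀ x : E3, ‖x‖ ≤ K * Real.sqrt (-s) → amp u s x ≤ ε) →
    ∀ t < 0, ∀ x, u t x = 0

/-- **Row A2epC holds.** -/
theorem row_A2epC : Row_A2epC := by
  intro C u hu h
  by_contra hne
  push Not at hne
  obtain ⟨t₀, ht₀, x₀, hx₀⟩ := hne
  obtain ⟨ε, hε, K, hK, hsub⟩ := ScenarioCensus.ScrewBlowdown.substantial_at_large_scales C
  obtain ⟨μ₁, hμ₁, hloud⟩ := hsub u hu ⟨t₀, ht₀, x₀, hx₀⟩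
  have hμ₁2 : 0 < μ₁ ^ 2 := pow_pos hμ₁ 2
  obtain ⟨s, hs, hqs⟩ := h ε hε K hK (-(μ₁ ^ 2)) (by linarith)
  have hs0 : 0 < -s := by linarith
  have hμpos : 0 < Real.sqrt (-s) := Real.sqrt_pos.2 hs0
  have hμ : μ₁ ≤ Real.sqrt (-s) := by
    rw [show μ₁ = Real.sqrt (μ₁ ^ 2) from (Real.sqrt_sq hμ₁.le).symm]
    exact Real.sqrt_le_sqrt (by linarith)
  obtain ⟨y, hyK, hbig⟩ := hloud _ hμ
  have htime : Real.sqrt (-s) ^ 2 * (-1 : ℝ) = s := by rw [Real.sq_sqrt hs0.le]; ring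
  have hread : ‖nsRescale (Real.sqrt (-s)) u (-1) y‖ = amp u s (Real.sqrt (-s) • y) := by
    simp only [nsRescale, htime, amp, norm_smul, Real.norm_eq_abs, abs_of_pos hμpos]
  have hxK : ‖Real.sqrt (-s) • y‖ ≤ K * Real.sqrt (-s) := by
    rw [norm_smul, Real.norm_eq_abs, abs_of_pos hμpos, mul_comm]
    exact mul_le_mul_of_nonneg_right hyK hμpos.le
  have h1 := hqs _ hxK
  rw [← hread] at h1
  exact absurd h1 (not_le.2 hbig)

/-- **Row A2epB** — receding ALL-SPACE quiet epochs of ONE FIXED log-length `log r` (`r > 1`) at one level `ε < 1`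
⇒ `u ≡ 0`.  OPEN (typed): the discretely-self-similar-type cell (`dss_receding_epochs`). -/
@[conjecture] def Row_A2epB : Prop :=
  ∀ (C : ℝ) (u : ℝ → E3 → E3), IsTypeIAncientMild C u →
    (∃ ε : ℝ, ε < 1 ∧ ∃ r : ℝ, 1 < r ∧ ∀ T : ℝ, T < 0 → ∃ a b : ℝ, a < b ∧ b ≤ T ∧ a ≤ r * b ∧ EpochQuietAll ε u a b) →
    ∀ t < 0, ∀ x, u t x = 0

/-- **Row A2epU** — receding quiet epochs of UNBOUNDED log-length on cores of ONE FIXED aperture `K`, one level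
`ε < 1` ⇒ `u ≡ 0`.  OPEN (typed): the extracted blow-down limit is quiet only inside the paraboloid
`‖x‖ ≤ K√(−t)` (self-similar-type cell); at the small level of `Row_A2epC` single slices already decide it. -/
@[conjecture] def Row_A2epU : Prop :=
  ∀ (C : ℝ) (u : ℝ → E3 → E3), IsTypeIAncientMild C u →
    (∃ ε : ℝ, ε < 1 ∧ ∃ K : ℝ, 0 < K ∧ ∀ r T : ℝ, T < 0 → ∃ a b : ℝ, a < b ∧ b ≤ T ∧ a ≤ r * b ∧ EpochQuiet ε K u a b) →
    ∀ t < 0, ∀ x, u t x = 0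

/-- Nesting: the fixed-length cell implies the unbounded-length cell. -/
theorem row_A2epA_of_row_A2epB (h : Row_A2epB) : Row_A2epA := by
  intro C u hu ⟨ε, hε, hyp⟩
  exact h C u hu ⟨ε, hε, 2, one_lt_two, fun T hT => hyp 2 T hT⟩

/-- Nesting: the fixed-aperture cell implies the growing-aperture cell's all-space form. -/
theorem row_A2epA_of_row_A2epU (h : Row_A2epU) : Row_A2epA := by
  intro C u hu ⟨ε, hε, hyp⟩
  refine h C u hu ⟨ε, hε, 1, one_pos, fun r T hT => ?_⟩
  obtain ⟨a, b, hab, hbT, hr, hq⟩ := hyp r T hT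
  exact ⟨a, b, hab, hbT, hr, hq.epochQuiet 1⟩

/-- Nesting: the sequence form implies the all-space `∀ r ∀ T` form. -/
theorem row_A2epA_of_row_A2epG (h : Row_A2epG) : Row_A2epA := fun C u hu ⟨ε, hε, hyp⟩ =>
  h C u hu ⟨ε, hε, hasLongQuietEpochs_of_forall hyp⟩

/-! ## E. (L′) decides every row BY NAME -/

/-- (L′) decides every row (informational). -/
theorem rows_of_L' (hL : ∀ (C : ℝ) (u : ℝ → E3 → E3), IsTypeIAncientMild C u → ∀ t < 0, ∀ x, u t x = 0) :
    Row_A2epG ∧ Row_A2epA ∧ Row_A2epC ∧ Row_A2epB ∧ Row_A2epU :=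
  ⟨fun C u hu _ => hL C u hu, fun C u hu _ => hL C u hu, fun C u hu _ => hL C u hu,
    fun C u hu _ => hL C u hu, fun C u hu _ => hL C u hu⟩

/-- The rung (L′) `Theses.SymmetryModuliCount.TypeIAncientLiouville` decides every row of this line. -/
theorem rows_of_rung (hL : Theses.SymmetryModuliCount.TypeIAncientLiouville) :
    Row_A2epG ∧ Row_A2epA ∧ Row_A2epC ∧ Row_A2epB ∧ Row_A2epU :=
  rows_of_L' fun C u hu => hL C u (isTypeIAncientMild_iff.1 hu)

/-! ## F. Controls and calibration -/

/-- Control: the zero field has long receding quiet epochs at every level `ε ≥ 0` (the rows' hypotheses are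
satisfiable; the class, not the reading, carries the exclusion). -/
theorem control_zero_longQuiet {ε : ℝ} (hε : 0 ≤ ε) : HasLongQuietEpochs ε (fun _ _ => (0 : E3)) := by
  have hnat : Tendsto (fun k : ℕ => (k : ℝ) + 2) atTop atTop :=
    tendsto_natCast_atTop_atTop.atTop_add tendsto_const_nhds
  refine ⟨fun k => -((k : ℝ) + 2) ^ 2, fun k => -((k : ℝ) + 2), fun k => (k : ℝ) + 2, fun k => ?_, ?_, ?_,
    hnat, fun k s _ _ x _ => by simp [amp, hε]⟩
  · have hk : (0 : ℝ) ≤ k := Nat.cast_nonneg k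
    show -((k : ℝ) + 2) ^ 2 < -((k : ℝ) + 2) ∧ -((k : ℝ) + 2) < 0
    constructor <;> nlinarith
  · exact tendsto_neg_atTop_atBot.comp hnat
  · refine tendsto_atTop_mono (fun k => ?_) hnat
    have hk : (0 : ℝ) ≤ k := Nat.cast_nonneg k
    show (k : ℝ) + 2 ≤ (-((k : ℝ) + 2) ^ 2) / (-((k : ℝ) + 2))
    rw [le_div_iff_of_neg (by linarith)]
    exact le_of_eq (by ring)

/-- Discrete self-similarity with factor `λ`: `u(λ² s, λ x) = λ⁻¹ u(s, x)`. -/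
def IsDSS (lam : ℝ) (u : ℝ → E3 → E3) : Prop :=
  ∀ (s : ℝ) (x : E3), u (lam ^ 2 * s) (lam • x) = lam⁻¹ • u s x

/-- The reading is DSS-invariant: `amp u (λ² s) (λ x) = amp u s x`. -/
theorem amp_dss {lam : ℝ} (hlam : 0 < lam) (h : IsDSS lam u) {s : ℝ} (_hs : s < 0) (x : E3) :
    amp u (lam ^ 2 * s) (lam • x) = amp u s x := by
  have hsq : Real.sqrt (-(lam ^ 2 * s)) = lam * Real.sqrt (-s) := by
    rw [show -(lam ^ 2 * s) = lam ^ 2 * (-s) by ring, Real.sqrt_mul (sq_nonneg _), Real.sqrt_sq hlam.le]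
  rw [amp, amp, h s x, hsq, norm_smul, norm_inv, Real.norm_eq_abs, abs_of_pos hlam]
  field_simp

/-- Control (motivates the OPEN `Row_A2epB`): for a `λ`-DSS field a quiet epoch RECURS one period earlier,
`[λ² a, λ² b]`, with the same log-length. -/
theorem dss_epoch_recur {lam ε a b : ℝ} (hlam : 0 < lam) (h : IsDSS lam u) (hb : b < 0)
    (hq : EpochQuietAll ε u a b) : EpochQuietAll ε u (lam ^ 2 * a) (lam ^ 2 * b) := by
  intro s has hsb x
  have hl2 : 0 < lam ^ 2 := pow_pos hlam 2
  -- write `s = λ² s'`, `x = λ x'`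
  set s' := s / lam ^ 2 with hs'
  have hss : s = lam ^ 2 * s' := by rw [hs']; field_simp
  have has' : a ≤ s' := by rw [hs', le_div_iff₀ hl2]; linarith
  have hsb' : s' ≤ b := by rw [hs', div_le_iff₀ hl2]; linarith
  have hs'0 : s' < 0 := lt_of_le_of_lt hsb' hb
  have hx : x = lam • (lam⁻¹ • x) := by rw [smul_smul, mul_inv_cancel₀ hlam.ne', one_smul]
  rw [hss, hx, amp_dss hlam h hs'0]
  exact hq s' has' hsb' _

/-- Control: hence ONE quiet epoch of a `λ`-DSS field (`λ > 1`) produces RECEDING quiet epochs of the same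
log-length before every horizon — exactly the hypothesis of the OPEN `Row_A2epB` (whether a nonzero DSS element
of the class exists is open; census D-block). -/
theorem dss_receding_epochs {lam ε a b : ℝ} (hlam : 1 < lam) (h : IsDSS lam u) (hab : a < b) (hb : b < 0)
    (hq : EpochQuietAll ε u a b) :
    ∀ T : ℝ, T < 0 → ∃ a' b' : ℝ, a' < b' ∧ b' ≤ T ∧ a' ≤ (a / b) * b' ∧ EpochQuietAll ε u a' b' := by
  have hlam0 : 0 < lam := one_pos.trans hlam
  have hl2 : 1 < lam ^ 2 := by nlinarith
  -- iterate the recurrence: `[λ^{2n} a, λ^{2n} b]` is quiet for every `n`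
  have hiter : ∀ n : ℕ, EpochQuietAll ε u ((lam ^ 2) ^ n * a) ((lam ^ 2) ^ n * b) := by
    intro n
    induction n with
    | zero => simpa using hq
    | succ m ih =>
        have hbm : (lam ^ 2) ^ m * b < 0 := mul_neg_of_pos_of_neg (pow_pos (by positivity) m) hb
        have := dss_epoch_recur hlam0 h hbm ih
        simpa [pow_succ, mul_comm, mul_left_comm, mul_assoc] using this
  intro T hT
  -- choose `n` with `(λ²)^n · (−b) ≥ −T`
  obtain ⟨n, hn⟩ := ((tendsto_pow_atTop_atTop_of_one_lt hl2).atTop_mul_const (by linarith : 0 < -b)).eventually_ge_atTop (-T) |>.exists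
  have hpow : 0 < (lam ^ 2) ^ n := pow_pos (by positivity) n
  refine ⟨(lam ^ 2) ^ n * a, (lam ^ 2) ^ n * b, mul_lt_mul_of_pos_left hab hpow, by linarith, ?_, hiter n⟩
  have hb0 : b ≠ 0 := hb.ne
  rw [show a / b * ((lam ^ 2) ^ n * b) = (lam ^ 2) ^ n * a by
    rw [div_mul_eq_mul_div, div_eq_iff hb0]; ring]

/-- Control: the hypothesis of the OPEN `Row_A2epB` is met by every `λ`-DSS field with ONE all-space quiet epoch
of ratio `a/b` (so a refutation of `Row_A2epB` is exactly a nonzero DSS-type element with a quiet phase). -/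
theorem control_dss_rowB_hypothesis {lam ε a b : ℝ} (hlam : 1 < lam) (h : IsDSS lam u) (hab : a < b)
    (hb : b < 0) (hq : EpochQuietAll ε u a b) :
    ∃ r : ℝ, 1 < r ∧ ∀ T : ℝ, T < 0 → ∃ a' b' : ℝ, a' < b' ∧ b' ≤ T ∧ a' ≤ r * b' ∧ EpochQuietAll ε u a' b' := by
  refine ⟨a / b, ?_, dss_receding_epochs hlam h hab hb hq⟩
  rw [lt_div_iff_of_neg hb, one_mul]
  exact hab

end Summit.NavierStokesRegularity.NavierStokesRegularity.Theorems.ScenarioCensus.EpochMeter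

namespace Summit.NavierStokesRegularity.NavierStokesRegularity.Theorems.ScenarioCensus

/-! ## Census KEYS (ns `…Theorems.ScenarioCensus`): instrument EPOCH METER (block A2) — TREE-decided cells A2epG / A2epA / A2epC, OPEN rows A2epB / A2epU -/

/-- **Cell A2epG** (receding quiet epochs with log-lengths `→ ∞` on cores of GROWING aperture, one level `ε < 1` ⇒ `u ≡ 0`; master row): `:= EpochMeter.Row_A2epG`. DECIDED. -/
def Row_A2epG : Prop := EpochMeter.Row_A2epG
/-- A2epG is EXCLUDED (decided in the tree): `EpochMeter.row_A2epG`. -/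
theorem row_A2epG_excluded : Row_A2epG := EpochMeter.row_A2epG

/-- **Cell A2epA** (quiet epochs of every log-length at ALL `x`, one level `ε < 1`): `:= EpochMeter.Row_A2epA`. DECIDED. -/
def Row_A2epA : Prop := EpochMeter.Row_A2epA
/-- A2epA is EXCLUDED (decided in the tree): `EpochMeter.row_A2epA`. -/
theorem row_A2epA_excluded : Row_A2epA := EpochMeter.row_A2epA

/-- **Cell A2epC** (calibration corner: quiet core slices at every level and every aperture): `:= EpochMeter.Row_A2epC`. DECIDED. -/
def Row_A2epC : Prop := EpochMeter.Row_A2epC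
/-- A2epC is EXCLUDED (decided in the tree): `EpochMeter.row_A2epC`. -/
theorem row_A2epC_excluded : Row_A2epC := EpochMeter.row_A2epC

/-- **Row A2epB** (quiet epochs of ONE FIXED log-length ratio `r > 1`) — typed only: `:= EpochMeter.Row_A2epB`. OPEN. -/
@[conjecture] def Row_A2epB : Prop := EpochMeter.Row_A2epB

/-- **Row A2epU** (quiet epochs of UNBOUNDED log-length on cores of ONE FIXED aperture) — typed only: `:= EpochMeter.Row_A2epU`. OPEN. -/
@[conjecture] def Row_A2epU : Prop := EpochMeter.Row_A2epU

/-- Lattice edges at key level: A2epB → A2epA, A2epU → A2epA, A2epG → A2epA (`EpochMeter.row_A2epA_of_row_A2epB` / `…_of_row_A2epU` / `…_of_row_A2epG`). -/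
theorem row_A2epA_of_row_A2epB : Row_A2epB → Row_A2epA := EpochMeter.row_A2epA_of_row_A2epB
/-- See `row_A2epA_of_row_A2epB`. -/
theorem row_A2epA_of_row_A2epU : Row_A2epU → Row_A2epA := EpochMeter.row_A2epA_of_row_A2epU
/-- See `row_A2epA_of_row_A2epB`. -/
theorem row_A2epA_of_row_A2epG : Row_A2epG → Row_A2epA := EpochMeter.row_A2epA_of_row_A2epG

end Summit.NavierStokesRegularity.NavierStokesRegularity.Theorems.ScenarioCensus

end
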